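import Literature.NumberTheory.GaloisRepresentations.PairingAnnihilatorOfInf
import HarnessLib

/-!
# A hyperbolic PLANE has exactly two isotropic lines: two isotropic lines avoiding a common
# isotropic third one COINCIDE (team n1011, row T-2LL "two Lagrangian lines", FILE 2a = the
# dim-`2` sibling of p12's `LagrangianComplementDichotomy.lean`, same namespace at route planner
# 1's request (ROUTE-1 §44 (2)); seat p04 GEN 11; pure finite-group algebra — no cohomology)

HONEST FRAMING (cell `b2b-bsdres`, run/shared/lean/b2b/bsd-rank1-residual/, verbatim in every
file): the goal of the cell is to DELETE the COMBINATION-SHAPED residual classes of the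
Birch–Swinnerton-Dyer formula for ALL analytic-rank `≤ 1` elliptic curves over `ℚ` — "full BSD
formula for every rank `≤ 1` curve in class `C`" assembled STRICTLY from published theorems — so
that the rank-`≤ 1` remainder becomes exactly the CONSTRUCTION-SHAPED classes, which are TYPED
(missing-input `Prop`s), NOT attempted. This is not "finishing BSD". Team n1011 (N10 / N11, the
additive block X4 ∧ `p = 3`): research route on the CONSTRUCTION-SHAPED class X4; no claim beyond
the stated classes; nothing is booked; no mark / label / count is changed by this file. TOOL
THEOREMS ONLY: no definition, no named fact, no `sorry`; they close nothing by themselves.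

## What

The linear algebra behind KIND (vii) of the visibility certificate (FILE 2 of the row,
`TwoLagrangianLinesLocal.lean`): at a place `w ∤ p` where two `p`-congruent curves both have ONE
rational line of `p`-torsion, `H = H¹(K_w, E[p])` has order `p²` and the Weil cup product is a
SYMMETRIC non-degenerate pairing on it — a hyperbolic plane over `𝔽_p` — whose isotropic lines are
exactly two; the Kummer line `𝓛`, the transported Kummer line `θ_* 𝓛′` and the unramified line are
isotropic, and the unramified line is neither of the first two, so `𝓛 = θ_* 𝓛′`. Stated for the
consumer in FINITE-GROUP currency (no vector-space structure is put on `H¹`):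

* `eq_zmultiples_of_card_eq_prime`, `eq_or_inf_eq_bot_of_card_eq_prime` — subgroups of prime order
  are cyclic on each non-zero element; two of them are equal or meet trivially;
* **`eq_of_isotropic_lines_of_isotropic_not_mem`** — `H` an abelian group of order `p²` killed by
  `p` (`p` an ODD prime, `hp2` explicit), `b : H × H → C` a symmetric biadditive pairing, `L, M ≤ H`
  isotropic of order `p`, `L` its own left annihilator, `u ∈ H` isotropic with `u ∉ L`, `u ∉ M`
  ⟹ `M = L`. (If `L ⊓ M = ⊥` then `H = L ⊕ M`, `u = l + m`, `0 = b(u,u) = 2 b(l,m)` and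
  `p · b(l,m) = 0`, so `b(l,m) = 0`, `m ⊥ ℤ l = L`, `m ∈ L ⊓ M = 0`, `u ∈ L` — absurd.)

Companion of p12's PART A of T-K43-TOOL (`LagrangianDichotomy.eq_or_inf_eq_bot_of_isotropic_of_isCompl`:
dimension-`2` Lagrangians `L, L′` complementary to an isotropic `W` in a symmetric space are equal or
transverse — r1's LEMMA 43.1 at the additive place `3`, `dim H¹ = 4`); here `dim H¹ = 2` (the tame
places `w ∤ 3` with `dim E[3]^{G_w} = 1`, r1's L44) and transversality is EXCLUDED by a third
isotropic line. Nothing of PART A is restated or re-proved.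

References: cells/n1011/ROUTE-1.md §44 (planner r1, GEN 32: "a non-degenerate symmetric plane over a
field of characteristic ≠ 2 has at most two isotropic lines"); folklore (hyperbolic planes, e.g.
[MilnorHusemoller1973] J. Milnor, D. Husemoller, *Symmetric bilinear forms*, Ch. I §6 — no statement
of that book is transcribed here).
-/

namespace Summit.BirchSwinnertonDyer.Rank1Residual.GaloisImage.LagrangianDichotomy

open Literature.NumberTheory.GaloisRepresentations

/-- A subgroup of prime order is generated by each of its non-zero elements. [folklore] -/
theorem eq_zmultiples_of_card_eq_prime {H : Type*} [AddCommGroup H] {p : ℕ} (hp : p.Prime)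
    (L : AddSubgroup H) (hL : Nat.card L = p) {l : H} (hl : l ∈ L) (hl0 : l ≠ 0) :
    L = AddSubgroup.zmultiples l := by
  haveI : Finite L := Nat.finite_of_card_ne_zero (by rw [hL]; exact hp.ne_zero)
  have hle : AddSubgroup.zmultiples l ≤ L := AddSubgroup.zmultiples_le_of_mem hl
  have hdvd : addOrderOf l ∣ p := by
    rw [← hL]
    have h := addOrderOf_dvd_natCard (⟨l, hl⟩ : L)
    rwa [← addOrderOf_injective L.subtype Subtype.val_injective (⟨l, hl⟩ : L)] at h
  have hord : addOrderOf l = p := by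
    rcases (Nat.dvd_prime hp).mp hdvd with h1 | h1
    · exact absurd (AddMonoid.addOrderOf_eq_one_iff.mp h1) hl0
    · exact h1
  exact (AddSubgroup.eq_of_le_of_card_ge hle (by rw [hL, Nat.card_zmultiples, hord])).symm

/-- Two subgroups of prime order `p` are equal or meet trivially. [folklore] -/
theorem eq_or_inf_eq_bot_of_card_eq_prime {H : Type*} [AddCommGroup H] {p : ℕ} (hp : p.Prime)
    (L M : AddSubgroup H) (hL : Nat.card L = p) (hM : Nat.card M = p) : M = L ∨ L ⊓ M = ⊥ := by
  by_cases h : L ⊓ M = ⊥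
  · exact Or.inr h
  · left
    obtain ⟨x, hx, hx0⟩ : ∃ x ∈ L ⊓ M, x ≠ 0 := by
      by_contra hall
      push Not at hall
      exact h ((AddSubgroup.eq_bot_iff_forall _).mpr hall)
    rw [eq_zmultiples_of_card_eq_prime hp M hM hx.2 hx0, eq_zmultiples_of_card_eq_prime hp L hL hx.1 hx0]

/-- **A hyperbolic plane has at most two isotropic lines** — finite-group form. Let `H` be an
abelian group of order `p²` (`p` an odd prime) killed by `p`, `b : H × H → C` a SYMMETRIC biadditive
pairing, `L, M ≤ H` subgroups of order `p` which are ISOTROPIC (`b(L, L) = 0 = b(M, M)`), `L` being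
moreover its own (left) annihilator (`(∀ y ∈ L, b x y = 0) → x ∈ L` — non-degeneracy of `b` read on
`L`), and `u ∈ H` an isotropic element (`b u u = 0`) lying in NEITHER `L` nor `M`. Then `M = L`.
(Otherwise `L ⊓ M = ⊥`, `H = L ⊕ M`, `u = l + m` with `l, m ≠ 0`; `0 = b u u = 2·b l m` and
`p·b l m = 0` give `b l m = 0`, so `m ⊥ ℤl = L`, `m ∈ L`, `m ∈ L ⊓ M = 0` — absurd.) Over `𝔽_p`:
a non-degenerate symmetric plane containing the isotropic lines `L ≠ M` has no third isotropic
vector; the dim-`2` sibling of `eq_or_inf_eq_bot_of_isotropic_of_isCompl` (p12, ROUTE-1 §43.1).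
[folklore] -/
theorem eq_of_isotropic_lines_of_isotropic_not_mem {H C : Type*} [AddCommGroup H] [AddCommGroup C]
    {p : ℕ} (hp : p.Prime) (hp2 : p ≠ 2) (b : H →+ H →+ C) (hsymm : ∀ x y, b x y = b y x)
    (hH : ∀ x : H, p • x = 0) (hcard : Nat.card H = p ^ 2)
    (L M : AddSubgroup H) (hL : Nat.card L = p) (hM : Nat.card M = p)
    (hLL : ∀ x ∈ L, ∀ y ∈ L, b x y = 0) (hMM : ∀ x ∈ M, ∀ y ∈ M, b x y = 0)
    (hLmax : ∀ x, (∀ y ∈ L, b x y = 0) → x ∈ L)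
    {u : H} (hu : b u u = 0) (huL : u ∉ L) (huM : u ∉ M) : M = L := by
  rcases eq_or_inf_eq_bot_of_card_eq_prime hp L M hL hM with h | hbot
  · exact h
  exfalso
  haveI : Finite H := Nat.finite_of_card_ne_zero (by rw [hcard]; exact pow_ne_zero 2 hp.ne_zero)
  -- `L ⊔ M = ⊤`
  have hsup : L ⊔ M = ⊤ := by
    apply AddSubgroup.eq_top_of_card_eq
    have h := natCard_sup_mul_natCard_inf L M
    rw [hbot, AddSubgroup.card_bot, mul_one, hL, hM] at h
    rw [h, hcard, sq]
  -- `u = l + m`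
  have hu' : u ∈ L ⊔ M := by rw [hsup]; exact AddSubgroup.mem_top u
  obtain ⟨l, hl, m, hm, rfl⟩ := AddSubgroup.mem_sup.mp hu'
  have hm0 : m ≠ 0 := by rintro rfl; exact huL (by rwa [add_zero])
  have hl0 : l ≠ 0 := by rintro rfl; exact huM (by rwa [zero_add])
  -- `b l m = 0`
  have h2 : (2 : ℕ) • b l m = 0 := by
    have e := hu
    simp only [map_add, AddMonoidHom.add_apply, hLL l hl l hl, hMM m hm m hm, hsymm m l, zero_add,
      add_zero] at e
    rw [two_nsmul]; exact e
  have hpb : p • b l m = 0 := by rw [← map_nsmul, hH m, map_zero]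
  have hlm : b l m = 0 := by
    obtain ⟨k, hk⟩ := hp.odd_of_ne_two hp2
    have : (2 * k + 1) • b l m = 0 := by rw [← hk]; exact hpb
    rwa [add_nsmul, one_nsmul, mul_nsmul, h2, nsmul_zero, zero_add] at this
  -- `m ∈ L`
  have hmL : m ∈ L := by
    refine hLmax m fun y hy ↦ ?_
    rw [eq_zmultiples_of_card_eq_prime hp L hL hl hl0] at hy
    obtain ⟨k, rfl⟩ := AddSubgroup.mem_zmultiples_iff.mp hy
    rw [map_zsmul, hsymm m l, hlm, zsmul_zero]
  have : m ∈ L ⊓ M := ⟨hmL, hm⟩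
  rw [hbot, AddSubgroup.mem_bot] at this
  exact hm0 this

end Summit.BirchSwinnertonDyer.Rank1Residual.GaloisImage.LagrangianDichotomy
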